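import Mathlib.Tactic.Ring
import Mathlib.Tactic.Linarith
import Mathlib.Tactic.Positivity
import Mathlib.Tactic.LinearCombination
import Mathlib.Tactic.FinCases
import Mathlib.Data.Real.Basic
import Mathlib.Data.Fin.VecNotation
import Mathlib.Algebra.BigOperators.Fin
import Literature.AlgebraicGeometry.HodgeTheory.WeilClassTestChargeZeroLemmaStepOne
import Summits.HodgeConjecture.HodgeConjecture.Theorems.WeilClassTestChargeZeroHyperplane
import HarnessLib

/-!
# Conjecture N (hodge-weil ladder, GAPS G51), format (6,4): `Q₂ ≥ 0` (Lemma N₂′ kernel-complete in the design format) and `G_λ ≥ 0` whenever `Q₄ ≥ 0`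

Prover 2, generation 15 (note `run/shared/lean/b2b/hodge-weil/b2b-hweil-pv2-g15/DIVIDED-DIFFERENCE-G15.md` §3); companion of
`WeilClassTestFormatFiveThreeQ2.lean`. Format (6,4) is the format of the ladder's corank-one determinantal designs (door A). pv2-g8's
LEMMA N₂′ (`CHARGE-ZERO-LEMMA.md` §4: centring + (P1) + (P3) + N-dominance ⟹ `Q₂ ≥ 0`): Steps 1–2 for format (6,4) are the referee-anchored
identities `stepOne_64`, `stepTwo_64` of `Literature/…/WeilClassTestChargeZeroLemmaStepOne.lean`, Step 3 is
`WeilClassTestChargeZeroHyperplane.core_form_nonneg_of_nonneg` (any finite family of atoms), here specialised to ten explicit atoms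
(`core_form_nonneg_ten`, index type `Fin 6 ⊕ Fin 4`); the assembly `Q2_nonneg_64` takes `s = max_g B_g`, `T = −2s`, atoms
`p = (A_e − s; s − B_g)`, `x = (A_e − s; B_g − s)`, `g = (u_e; v_g)`. CONSEQUENCE (`conjectureN_64_of_Q4_nonneg`): every centred, pure,
pairwise-ample real (6,4) configuration with `Q₄ ≥ 0` satisfies `Q₂ + λQ₄ ≥ 0` for all `λ ≥ 0`. Pure algebra; nothing here is a case of HC,
a rung or a door edge; no statement of Markman's papers is used. New cell result ⇒ Summits/.
-/

set_option linter.dupNamespace false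

open Finset
open Summit.HodgeConjecture.HodgeConjecture.WeilClassTestChargeZeroHyperplane
open Literature.AlgebraicGeometry.HodgeTheory.WeilClassTestChargeZeroLemma

namespace Summit.HodgeConjecture.HodgeConjecture.WeilClassTestFormatSixFourQ2

/-- `core_form_nonneg_of_nonneg` for TEN explicit atoms (the (6,4) format has `6 + 4` roots), via the index type `Fin 6 ⊕ Fin 4`. -/
theorem core_form_nonneg_ten (p₁ p₂ p₃ p₄ p₅ p₆ p₇ p₈ p₉ p₁₀ x₁ x₂ x₃ x₄ x₅ x₆ x₇ x₈ x₉ x₁₀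
    g₁ g₂ g₃ g₄ g₅ g₆ g₇ g₈ g₉ g₁₀ T M : ℝ)
    (hp₁ : 0 ≤ p₁) (hp₂ : 0 ≤ p₂) (hp₃ : 0 ≤ p₃) (hp₄ : 0 ≤ p₄) (hp₅ : 0 ≤ p₅)
    (hp₆ : 0 ≤ p₆) (hp₇ : 0 ≤ p₇) (hp₈ : 0 ≤ p₈) (hp₉ : 0 ≤ p₉) (hp₁₀ : 0 ≤ p₁₀)
    (hx₁ : |x₁| ≤ p₁) (hx₂ : |x₂| ≤ p₂) (hx₃ : |x₃| ≤ p₃) (hx₄ : |x₄| ≤ p₄) (hx₅ : |x₅| ≤ p₅)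
    (hx₆ : |x₆| ≤ p₆) (hx₇ : |x₇| ≤ p₇) (hx₈ : |x₈| ≤ p₈) (hx₉ : |x₉| ≤ p₉) (hx₁₀ : |x₁₀| ≤ p₁₀)
    (hT : T = p₁ + p₂ + p₃ + p₄ + p₅ + p₆ + p₇ + p₈ + p₉ + p₁₀)
    (hM : M = x₁ * p₁ + x₂ * p₂ + x₃ * p₃ + x₄ * p₄ + x₅ * p₅ + x₆ * p₆ + x₇ * p₇ + x₈ * p₈ + x₉ * p₉ + x₁₀ * p₁₀)
    (hg : p₁ * (T - x₁) * g₁ + p₂ * (T - x₂) * g₂ + p₃ * (T - x₃) * g₃ + p₄ * (T - x₄) * g₄ + p₅ * (T - x₅) * g₅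
       + p₆ * (T - x₆) * g₆ + p₇ * (T - x₇) * g₇ + p₈ * (T - x₈) * g₈ + p₉ * (T - x₉) * g₉ + p₁₀ * (T - x₁₀) * g₁₀ = 0) :
    0 ≤ (p₁ * (T ^ 2 + M - 3 * T * x₁) * g₁ ^ 2 + p₂ * (T ^ 2
       + M - 3 * T * x₂) * g₂ ^ 2 + p₃ * (T ^ 2 + M - 3 * T * x₃) * g₃ ^ 2
       + p₄ * (T ^ 2 + M - 3 * T * x₄) * g₄ ^ 2 + p₅ * (T ^ 2
       + M - 3 * T * x₅) * g₅ ^ 2 + p₆ * (T ^ 2 + M - 3 * T * x₆) * g₆ ^ 2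
       + p₇ * (T ^ 2 + M - 3 * T * x₇) * g₇ ^ 2 + p₈ * (T ^ 2
       + M - 3 * T * x₈) * g₈ ^ 2 + p₉ * (T ^ 2 + M - 3 * T * x₉) * g₉ ^ 2
       + p₁₀ * (T ^ 2 + M - 3 * T * x₁₀) * g₁₀ ^ 2)
      + T * (p₁ * g₁ + p₂ * g₂ + p₃ * g₃ + p₄ * g₄ + p₅ * g₅ + p₆ * g₆ + p₇ * g₇ + p₈ * g₈ + p₉ * g₉ + p₁₀ * g₁₀) ^ 2 := by
  have h := core_form_nonneg_of_nonneg (ι := Fin 6 ⊕ Fin 4)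
    (Sum.elim (![p₁, p₂, p₃, p₄, p₅, p₆] : Fin 6 → ℝ) (![p₇, p₈, p₉, p₁₀] : Fin 4 → ℝ))
    (Sum.elim (![x₁, x₂, x₃, x₄, x₅, x₆] : Fin 6 → ℝ) (![x₇, x₈, x₉, x₁₀] : Fin 4 → ℝ))
    (by intro k; rcases k with k | k <;> fin_cases k <;> simpa) (by intro k; rcases k with k | k <;> fin_cases k <;> simpa) T M
    (by rw [hT]; simp [Fintype.sum_sum_type, Fin.sum_univ_six, Fin.sum_univ_four]; ring)
    (by rw [hM]; simp [Fintype.sum_sum_type, Fin.sum_univ_six, Fin.sum_univ_four]; ring)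
    (fun k => T ^ 2 + M - 3 * T * (Sum.elim (![x₁, x₂, x₃, x₄, x₅, x₆] : Fin 6 → ℝ) (![x₇, x₈, x₉, x₁₀] : Fin 4 → ℝ)) k)
    (fun k => rfl)
    (Sum.elim (![g₁, g₂, g₃, g₄, g₅, g₆] : Fin 6 → ℝ) (![g₇, g₈, g₉, g₁₀] : Fin 4 → ℝ))
    (by simp [Fintype.sum_sum_type, Fin.sum_univ_six, Fin.sum_univ_four]; linear_combination hg)
  simp [Fintype.sum_sum_type, Fin.sum_univ_six, Fin.sum_univ_four] at h
  linear_combination h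

/-- **LEMMA N₂′ IN FORMAT (6,4), kernel-complete.** Centred positions and charges, (P1), (P3) and weak N-dominance `B_g ≤ A_e` ⟹ `Q₂ ≥ 0`. -/
theorem Q2_nonneg_64 (A₁ A₂ A₃ A₄ A₅ A₆ B₁ B₂ B₃ B₄ u₁ u₂ u₃ u₄ u₅ u₆ v₁ v₂ v₃ v₄ : ℝ)
    (hA : A₁ + A₂ + A₃ + A₄ + A₅ + A₆ = B₁ + B₂ + B₃ + B₄) (hC : u₁ + u₂ + u₃ + u₄ + u₅ + u₆ = v₁ + v₂ + v₃ + v₄)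
    (hP1 : (A₁ ^ 2 * u₁ + A₂ ^ 2 * u₂ + A₃ ^ 2 * u₃ + A₄ ^ 2 * u₄ + A₅ ^ 2 * u₅ + A₆ ^ 2 * u₆) - (B₁ ^ 2 * v₁ + B₂ ^ 2 * v₂ + B₃ ^ 2 * v₃ + B₄ ^ 2 * v₄) = 0)
    (hP2 : (A₁ * u₁ ^ 2 + A₂ * u₂ ^ 2 + A₃ * u₃ ^ 2 + A₄ * u₄ ^ 2 + A₅ * u₅ ^ 2 + A₆ * u₆ ^ 2) - (B₁ * v₁ ^ 2 + B₂ * v₂ ^ 2 + B₃ * v₃ ^ 2 + B₄ * v₄ ^ 2) = 0)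
    (d₁₁ : B₁ ≤ A₁) (d₂₁ : B₁ ≤ A₂) (d₃₁ : B₁ ≤ A₃) (d₄₁ : B₁ ≤ A₄) (d₅₁ : B₁ ≤ A₅) (d₆₁ : B₁ ≤ A₆)
    (d₁₂ : B₂ ≤ A₁) (d₂₂ : B₂ ≤ A₂) (d₃₂ : B₂ ≤ A₃) (d₄₂ : B₂ ≤ A₄) (d₅₂ : B₂ ≤ A₅) (d₆₂ : B₂ ≤ A₆)
    (d₁₃ : B₃ ≤ A₁) (d₂₃ : B₃ ≤ A₂) (d₃₃ : B₃ ≤ A₃) (d₄₃ : B₃ ≤ A₄) (d₅₃ : B₃ ≤ A₅) (d₆₃ : B₃ ≤ A₆)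
    (d₁₄ : B₄ ≤ A₁) (d₂₄ : B₄ ≤ A₂) (d₃₄ : B₄ ≤ A₃) (d₄₄ : B₄ ≤ A₄) (d₅₄ : B₄ ≤ A₅) (d₆₄ : B₄ ≤ A₆)
    :
    0 ≤ (1 / 2) * ((A₁ ^ 2 + A₂ ^ 2 + A₃ ^ 2 + A₄ ^ 2 + A₅ ^ 2 + A₆ ^ 2) - (B₁ ^ 2 + B₂ ^ 2 + B₃ ^ 2 + B₄ ^ 2)) * ((u₁ ^ 2 + u₂ ^ 2 + u₃ ^ 2 + u₄ ^ 2 + u₅ ^ 2 + u₆ ^ 2) - (v₁ ^ 2 + v₂ ^ 2 + v₃ ^ 2 + v₄ ^ 2))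
        + ((A₁ * u₁ + A₂ * u₂ + A₃ * u₃ + A₄ * u₄ + A₅ * u₅ + A₆ * u₆) - (B₁ * v₁ + B₂ * v₂ + B₃ * v₃ + B₄ * v₄)) ^ 2
        - 3 * ((A₁ ^ 2 * u₁ ^ 2 + A₂ ^ 2 * u₂ ^ 2 + A₃ ^ 2 * u₃ ^ 2 + A₄ ^ 2 * u₄ ^ 2 + A₅ ^ 2 * u₅ ^ 2 + A₆ ^ 2 * u₆ ^ 2) - (B₁ ^ 2 * v₁ ^ 2 + B₂ ^ 2 * v₂ ^ 2 + B₃ ^ 2 * v₃ ^ 2 + B₄ ^ 2 * v₄ ^ 2)) := by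
  -- s = max B, T = −2s
  set s : ℝ := max (max (max B₁ B₂) B₃) B₄ with hs
  have hB₁ : B₁ ≤ s := le_trans (le_trans (le_max_left _ _) (le_max_left _ _)) (le_max_left _ _)
  have hB₂ : B₂ ≤ s := le_trans (le_trans (le_max_right _ _) (le_max_left _ _)) (le_max_left _ _)
  have hB₃ : B₃ ≤ s := le_trans (le_max_right _ _) (le_max_left _ _)
  have hB₄ : B₄ ≤ s := le_max_right _ _
  have hA₁ : s ≤ A₁ := max_le (max_le (max_le d₁₁ d₁₂) d₁₃) d₁₄
  have hA₂ : s ≤ A₂ := max_le (max_le (max_le d₂₁ d₂₂) d₂₃) d₂₄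
  have hA₃ : s ≤ A₃ := max_le (max_le (max_le d₃₁ d₃₂) d₃₃) d₃₄
  have hA₄ : s ≤ A₄ := max_le (max_le (max_le d₄₁ d₄₂) d₄₃) d₄₄
  have hA₅ : s ≤ A₅ := max_le (max_le (max_le d₅₁ d₅₂) d₅₃) d₅₄
  have hA₆ : s ≤ A₆ := max_le (max_le (max_le d₆₁ d₆₂) d₆₃) d₆₄
  -- T = −2s ≥ 0; if T = 0 every position is 0 and Q₂ = 0
  have hTnn : 0 ≤ -2 * s := by linarith
  rcases eq_or_lt_of_le hTnn with hT0 | hTpos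
  · clear hP1 hP2 hC
    have e₁ : A₁ = 0 := by linarith
    have e₂ : A₂ = 0 := by linarith
    have e₃ : A₃ = 0 := by linarith
    have e₄ : A₄ = 0 := by linarith
    have e₅ : A₅ = 0 := by linarith
    have e₆ : A₆ = 0 := by linarith
    have f₁ : B₁ = 0 := by linarith
    have f₂ : B₂ = 0 := by linarith
    have f₃ : B₃ = 0 := by linarith
    have f₄ : B₄ = 0 := by linarith
    rw [e₁, e₂, e₃, e₄, e₅, e₆, f₁, f₂, f₃, f₄]; ring_nf; positivity
  have pA₁ : 0 ≤ A₁ - s := by linarith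
  have pA₂ : 0 ≤ A₂ - s := by linarith
  have pA₃ : 0 ≤ A₃ - s := by linarith
  have pA₄ : 0 ≤ A₄ - s := by linarith
  have pA₅ : 0 ≤ A₅ - s := by linarith
  have pA₆ : 0 ≤ A₆ - s := by linarith
  have pB₁ : 0 ≤ s - B₁ := by linarith
  have pB₂ : 0 ≤ s - B₂ := by linarith
  have pB₃ : 0 ≤ s - B₃ := by linarith
  have pB₄ : 0 ≤ s - B₄ := by linarith
  have xA₁ : |A₁ - s| ≤ A₁ - s := (abs_of_nonneg pA₁).le
  have xA₂ : |A₂ - s| ≤ A₂ - s := (abs_of_nonneg pA₂).le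
  have xA₃ : |A₃ - s| ≤ A₃ - s := (abs_of_nonneg pA₃).le
  have xA₄ : |A₄ - s| ≤ A₄ - s := (abs_of_nonneg pA₄).le
  have xA₅ : |A₅ - s| ≤ A₅ - s := (abs_of_nonneg pA₅).le
  have xA₆ : |A₆ - s| ≤ A₆ - s := (abs_of_nonneg pA₆).le
  have xB₁ : |B₁ - s| ≤ s - B₁ := by rw [abs_sub_comm]; exact (abs_of_nonneg pB₁).le
  have xB₂ : |B₂ - s| ≤ s - B₂ := by rw [abs_sub_comm]; exact (abs_of_nonneg pB₂).le
  have xB₃ : |B₃ - s| ≤ s - B₃ := by rw [abs_sub_comm]; exact (abs_of_nonneg pB₃).le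
  have xB₄ : |B₄ - s| ≤ s - B₄ := by rw [abs_sub_comm]; exact (abs_of_nonneg pB₄).le
  have hTsum : -2 * s = (A₁ - s) + (A₂ - s) + (A₃ - s) + (A₄ - s) + (A₅ - s) + (A₆ - s) + (s - B₁) + (s - B₂) + (s - B₃) + (s - B₄) := by
    linear_combination (-1 : ℝ) * hA
  have h2 := stepTwo_64 A₁ A₂ A₃ A₄ A₅ A₆ B₁ B₂ B₃ B₄ u₁ u₂ u₃ u₄ u₅ u₆ v₁ v₂ v₃ v₄ s hC (by linarith [hP1])
  have hg0 : (A₁ - s) * (-2 * s - (A₁ - s)) * u₁ + (A₂ - s) * (-2 * s - (A₂ - s)) * u₂ + (A₃ - s) * (-2 * s - (A₃ - s)) * u₃ + (A₄ - s) * (-2 * s - (A₄ - s)) * u₄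
       + (A₅ - s) * (-2 * s - (A₅ - s)) * u₅ + (A₆ - s) * (-2 * s - (A₆ - s)) * u₆ + (s - B₁) * (-2 * s - (B₁ - s)) * v₁ + (s - B₂) * (-2 * s - (B₂ - s)) * v₂
       + (s - B₃) * (-2 * s - (B₃ - s)) * v₃ + (s - B₄) * (-2 * s - (B₄ - s)) * v₄ = 0 := by
    linear_combination (-1 : ℝ) * h2
  clear h2
  have hcore := core_form_nonneg_ten (A₁ - s) (A₂ - s) (A₃ - s) (A₄ - s) (A₅ - s) (A₆ - s) (s - B₁) (s - B₂) (s - B₃) (s - B₄)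
    (A₁ - s) (A₂ - s) (A₃ - s) (A₄ - s) (A₅ - s) (A₆ - s) (B₁ - s) (B₂ - s) (B₃ - s) (B₄ - s) u₁ u₂ u₃ u₄ u₅ u₆ v₁ v₂ v₃ v₄
    (-2 * s) (((A₁ - s) ^ 2 + (A₂ - s) ^ 2 + (A₃ - s) ^ 2 + (A₄ - s) ^ 2 + (A₅ - s) ^ 2 + (A₆ - s) ^ 2) - ((s - B₁) ^ 2 + (s - B₂) ^ 2 + (s - B₃) ^ 2 + (s - B₄) ^ 2))
    pA₁ pA₂ pA₃ pA₄ pA₅ pA₆ pB₁ pB₂ pB₃ pB₄ xA₁ xA₂ xA₃ xA₄ xA₅ xA₆ xB₁ xB₂ xB₃ xB₄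
    hTsum (by ring) hg0
  clear hg0
  have h1 := stepOne_64 A₁ A₂ A₃ A₄ A₅ A₆ B₁ B₂ B₃ B₄ u₁ u₂ u₃ u₄ u₅ u₆ v₁ v₂ v₃ v₄ s hA (by linarith [hP2])
  have hsum : (A₁ - s) * u₁ + (A₂ - s) * u₂ + (A₃ - s) * u₃ + (A₄ - s) * u₄ + (A₅ - s) * u₅ + (A₆ - s) * u₆
      + (s - B₁) * v₁ + (s - B₂) * v₂ + (s - B₃) * v₃ + (s - B₄) * v₄
      = ((A₁ * u₁ + A₂ * u₂ + A₃ * u₃ + A₄ * u₄ + A₅ * u₅ + A₆ * u₆) - (B₁ * v₁ + B₂ * v₂ + B₃ * v₃ + B₄ * v₄)) := by linear_combination (-s) * hC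
  rw [hsum] at hcore
  have hcore' : 0 ≤ (-2 * s) * ((1 / 2) * ((A₁ ^ 2 + A₂ ^ 2 + A₃ ^ 2 + A₄ ^ 2 + A₅ ^ 2 + A₆ ^ 2) - (B₁ ^ 2 + B₂ ^ 2 + B₃ ^ 2 + B₄ ^ 2)) * ((u₁ ^ 2 + u₂ ^ 2 + u₃ ^ 2 + u₄ ^ 2 + u₅ ^ 2 + u₆ ^ 2) - (v₁ ^ 2 + v₂ ^ 2 + v₃ ^ 2 + v₄ ^ 2))
        + ((A₁ * u₁ + A₂ * u₂ + A₃ * u₃ + A₄ * u₄ + A₅ * u₅ + A₆ * u₆) - (B₁ * v₁ + B₂ * v₂ + B₃ * v₃ + B₄ * v₄)) ^ 2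
        - 3 * ((A₁ ^ 2 * u₁ ^ 2 + A₂ ^ 2 * u₂ ^ 2 + A₃ ^ 2 * u₃ ^ 2 + A₄ ^ 2 * u₄ ^ 2 + A₅ ^ 2 * u₅ ^ 2 + A₆ ^ 2 * u₆ ^ 2) - (B₁ ^ 2 * v₁ ^ 2 + B₂ ^ 2 * v₂ ^ 2 + B₃ ^ 2 * v₃ ^ 2 + B₄ ^ 2 * v₄ ^ 2))) := by
    rw [h1]; linear_combination hcore
  exact (mul_nonneg_iff_of_pos_left hTpos).mp hcore'

/-- Lemma N₂′ in format (6,4) under PAIRWISE AMPLENESS (which implies N-dominance). -/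
theorem Q2_nonneg_64_ample (A₁ A₂ A₃ A₄ A₅ A₆ B₁ B₂ B₃ B₄ u₁ u₂ u₃ u₄ u₅ u₆ v₁ v₂ v₃ v₄ : ℝ)
    (hA : A₁ + A₂ + A₃ + A₄ + A₅ + A₆ = B₁ + B₂ + B₃ + B₄) (hC : u₁ + u₂ + u₃ + u₄ + u₅ + u₆ = v₁ + v₂ + v₃ + v₄)
    (hP1 : (A₁ ^ 2 * u₁ + A₂ ^ 2 * u₂ + A₃ ^ 2 * u₃ + A₄ ^ 2 * u₄ + A₅ ^ 2 * u₅ + A₆ ^ 2 * u₆) - (B₁ ^ 2 * v₁ + B₂ ^ 2 * v₂ + B₃ ^ 2 * v₃ + B₄ ^ 2 * v₄) = 0)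
    (hP2 : (A₁ * u₁ ^ 2 + A₂ * u₂ ^ 2 + A₃ * u₃ ^ 2 + A₄ * u₄ ^ 2 + A₅ * u₅ ^ 2 + A₆ * u₆ ^ 2) - (B₁ * v₁ ^ 2 + B₂ * v₂ ^ 2 + B₃ * v₃ ^ 2 + B₄ * v₄ ^ 2) = 0)
    (m₁₁ : |u₁ - v₁| ≤ A₁ - B₁) (m₂₁ : |u₂ - v₁| ≤ A₂ - B₁) (m₃₁ : |u₃ - v₁| ≤ A₃ - B₁) (m₄₁ : |u₄ - v₁| ≤ A₄ - B₁) (m₅₁ : |u₅ - v₁| ≤ A₅ - B₁)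
    (m₆₁ : |u₆ - v₁| ≤ A₆ - B₁) (m₁₂ : |u₁ - v₂| ≤ A₁ - B₂) (m₂₂ : |u₂ - v₂| ≤ A₂ - B₂) (m₃₂ : |u₃ - v₂| ≤ A₃ - B₂) (m₄₂ : |u₄ - v₂| ≤ A₄ - B₂)
    (m₅₂ : |u₅ - v₂| ≤ A₅ - B₂) (m₆₂ : |u₆ - v₂| ≤ A₆ - B₂) (m₁₃ : |u₁ - v₃| ≤ A₁ - B₃) (m₂₃ : |u₂ - v₃| ≤ A₂ - B₃) (m₃₃ : |u₃ - v₃| ≤ A₃ - B₃)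
    (m₄₃ : |u₄ - v₃| ≤ A₄ - B₃) (m₅₃ : |u₅ - v₃| ≤ A₅ - B₃) (m₆₃ : |u₆ - v₃| ≤ A₆ - B₃) (m₁₄ : |u₁ - v₄| ≤ A₁ - B₄) (m₂₄ : |u₂ - v₄| ≤ A₂ - B₄)
    (m₃₄ : |u₃ - v₄| ≤ A₃ - B₄) (m₄₄ : |u₄ - v₄| ≤ A₄ - B₄) (m₅₄ : |u₅ - v₄| ≤ A₅ - B₄) (m₆₄ : |u₆ - v₄| ≤ A₆ - B₄)
    :
    0 ≤ (1 / 2) * ((A₁ ^ 2 + A₂ ^ 2 + A₃ ^ 2 + A₄ ^ 2 + A₅ ^ 2 + A₆ ^ 2) - (B₁ ^ 2 + B₂ ^ 2 + B₃ ^ 2 + B₄ ^ 2)) * ((u₁ ^ 2 + u₂ ^ 2 + u₃ ^ 2 + u₄ ^ 2 + u₅ ^ 2 + u₆ ^ 2) - (v₁ ^ 2 + v₂ ^ 2 + v₃ ^ 2 + v₄ ^ 2))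
        + ((A₁ * u₁ + A₂ * u₂ + A₃ * u₃ + A₄ * u₄ + A₅ * u₅ + A₆ * u₆) - (B₁ * v₁ + B₂ * v₂ + B₃ * v₃ + B₄ * v₄)) ^ 2
        - 3 * ((A₁ ^ 2 * u₁ ^ 2 + A₂ ^ 2 * u₂ ^ 2 + A₃ ^ 2 * u₃ ^ 2 + A₄ ^ 2 * u₄ ^ 2 + A₅ ^ 2 * u₅ ^ 2 + A₆ ^ 2 * u₆ ^ 2) - (B₁ ^ 2 * v₁ ^ 2 + B₂ ^ 2 * v₂ ^ 2 + B₃ ^ 2 * v₃ ^ 2 + B₄ ^ 2 * v₄ ^ 2)) :=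
  Q2_nonneg_64 A₁ A₂ A₃ A₄ A₅ A₆ B₁ B₂ B₃ B₄ u₁ u₂ u₃ u₄ u₅ u₆ v₁ v₂ v₃ v₄ hA hC hP1 hP2
    (sub_nonneg.mp <| (abs_nonneg _).trans m₁₁) (sub_nonneg.mp <| (abs_nonneg _).trans m₂₁) (sub_nonneg.mp <| (abs_nonneg _).trans m₃₁) (sub_nonneg.mp <| (abs_nonneg _).trans m₄₁) (sub_nonneg.mp <| (abs_nonneg _).trans m₅₁) (sub_nonneg.mp <| (abs_nonneg _).trans m₆₁)
    (sub_nonneg.mp <| (abs_nonneg _).trans m₁₂) (sub_nonneg.mp <| (abs_nonneg _).trans m₂₂) (sub_nonneg.mp <| (abs_nonneg _).trans m₃₂) (sub_nonneg.mp <| (abs_nonneg _).trans m₄₂) (sub_nonneg.mp <| (abs_nonneg _).trans m₅₂) (sub_nonneg.mp <| (abs_nonneg _).trans m₆₂)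
    (sub_nonneg.mp <| (abs_nonneg _).trans m₁₃) (sub_nonneg.mp <| (abs_nonneg _).trans m₂₃) (sub_nonneg.mp <| (abs_nonneg _).trans m₃₃) (sub_nonneg.mp <| (abs_nonneg _).trans m₄₃) (sub_nonneg.mp <| (abs_nonneg _).trans m₅₃) (sub_nonneg.mp <| (abs_nonneg _).trans m₆₃)
    (sub_nonneg.mp <| (abs_nonneg _).trans m₁₄) (sub_nonneg.mp <| (abs_nonneg _).trans m₂₄) (sub_nonneg.mp <| (abs_nonneg _).trans m₃₄) (sub_nonneg.mp <| (abs_nonneg _).trans m₄₄) (sub_nonneg.mp <| (abs_nonneg _).trans m₅₄) (sub_nonneg.mp <| (abs_nonneg _).trans m₆₄)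

/-- **CONJECTURE N IN FORMAT (6,4) ON THE HALF `Q₄ ≥ 0`.** A centred, pure ((P1), (P2)), pairwise-ample real (6,4) configuration with
`Q₄ ≥ 0` has `Q₂ + λ·Q₄ ≥ 0` for every `λ ≥ 0`. -/
theorem conjectureN_64_of_Q4_nonneg (A₁ A₂ A₃ A₄ A₅ A₆ B₁ B₂ B₃ B₄ u₁ u₂ u₃ u₄ u₅ u₆ v₁ v₂ v₃ v₄ : ℝ)
    (hA : A₁ + A₂ + A₃ + A₄ + A₅ + A₆ = B₁ + B₂ + B₃ + B₄) (hC : u₁ + u₂ + u₃ + u₄ + u₅ + u₆ = v₁ + v₂ + v₃ + v₄)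
    (hP1 : (A₁ ^ 2 * u₁ + A₂ ^ 2 * u₂ + A₃ ^ 2 * u₃ + A₄ ^ 2 * u₄ + A₅ ^ 2 * u₅ + A₆ ^ 2 * u₆) - (B₁ ^ 2 * v₁ + B₂ ^ 2 * v₂ + B₃ ^ 2 * v₃ + B₄ ^ 2 * v₄) = 0)
    (hP2 : (A₁ * u₁ ^ 2 + A₂ * u₂ ^ 2 + A₃ * u₃ ^ 2 + A₄ * u₄ ^ 2 + A₅ * u₅ ^ 2 + A₆ * u₆ ^ 2) - (B₁ * v₁ ^ 2 + B₂ * v₂ ^ 2 + B₃ * v₃ ^ 2 + B₄ * v₄ ^ 2) = 0)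
    (m₁₁ : |u₁ - v₁| ≤ A₁ - B₁) (m₂₁ : |u₂ - v₁| ≤ A₂ - B₁) (m₃₁ : |u₃ - v₁| ≤ A₃ - B₁) (m₄₁ : |u₄ - v₁| ≤ A₄ - B₁) (m₅₁ : |u₅ - v₁| ≤ A₅ - B₁)
    (m₆₁ : |u₆ - v₁| ≤ A₆ - B₁) (m₁₂ : |u₁ - v₂| ≤ A₁ - B₂) (m₂₂ : |u₂ - v₂| ≤ A₂ - B₂) (m₃₂ : |u₃ - v₂| ≤ A₃ - B₂) (m₄₂ : |u₄ - v₂| ≤ A₄ - B₂)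
    (m₅₂ : |u₅ - v₂| ≤ A₅ - B₂) (m₆₂ : |u₆ - v₂| ≤ A₆ - B₂) (m₁₃ : |u₁ - v₃| ≤ A₁ - B₃) (m₂₃ : |u₂ - v₃| ≤ A₂ - B₃) (m₃₃ : |u₃ - v₃| ≤ A₃ - B₃)
    (m₄₃ : |u₄ - v₃| ≤ A₄ - B₃) (m₅₃ : |u₅ - v₃| ≤ A₅ - B₃) (m₆₃ : |u₆ - v₃| ≤ A₆ - B₃) (m₁₄ : |u₁ - v₄| ≤ A₁ - B₄) (m₂₄ : |u₂ - v₄| ≤ A₂ - B₄)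
    (m₃₄ : |u₃ - v₄| ≤ A₃ - B₄) (m₄₄ : |u₄ - v₄| ≤ A₄ - B₄) (m₅₄ : |u₅ - v₄| ≤ A₅ - B₄) (m₆₄ : |u₆ - v₄| ≤ A₆ - B₄)
    (hQ4 : 0 ≤ 3 * ((u₁ ^ 4 + u₂ ^ 4 + u₃ ^ 4 + u₄ ^ 4 + u₅ ^ 4 + u₆ ^ 4) - (v₁ ^ 4 + v₂ ^ 4 + v₃ ^ 4 + v₄ ^ 4)) - (3 / 2) * ((u₁ ^ 2 + u₂ ^ 2 + u₃ ^ 2 + u₄ ^ 2 + u₅ ^ 2 + u₆ ^ 2) - (v₁ ^ 2 + v₂ ^ 2 + v₃ ^ 2 + v₄ ^ 2)) ^ 2)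
    (l : ℝ) (hl : 0 ≤ l) :
    0 ≤ (1 / 2) * ((A₁ ^ 2 + A₂ ^ 2 + A₃ ^ 2 + A₄ ^ 2 + A₅ ^ 2 + A₆ ^ 2) - (B₁ ^ 2 + B₂ ^ 2 + B₃ ^ 2 + B₄ ^ 2)) * ((u₁ ^ 2 + u₂ ^ 2 + u₃ ^ 2 + u₄ ^ 2 + u₅ ^ 2 + u₆ ^ 2) - (v₁ ^ 2 + v₂ ^ 2 + v₃ ^ 2 + v₄ ^ 2))
        + ((A₁ * u₁ + A₂ * u₂ + A₃ * u₃ + A₄ * u₄ + A₅ * u₅ + A₆ * u₆) - (B₁ * v₁ + B₂ * v₂ + B₃ * v₃ + B₄ * v₄)) ^ 2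
        - 3 * ((A₁ ^ 2 * u₁ ^ 2 + A₂ ^ 2 * u₂ ^ 2 + A₃ ^ 2 * u₃ ^ 2 + A₄ ^ 2 * u₄ ^ 2 + A₅ ^ 2 * u₅ ^ 2 + A₆ ^ 2 * u₆ ^ 2) - (B₁ ^ 2 * v₁ ^ 2 + B₂ ^ 2 * v₂ ^ 2 + B₃ ^ 2 * v₃ ^ 2 + B₄ ^ 2 * v₄ ^ 2))
      + l * (3 * ((u₁ ^ 4 + u₂ ^ 4 + u₃ ^ 4 + u₄ ^ 4 + u₅ ^ 4 + u₆ ^ 4) - (v₁ ^ 4 + v₂ ^ 4 + v₃ ^ 4 + v₄ ^ 4)) - (3 / 2) * ((u₁ ^ 2 + u₂ ^ 2 + u₃ ^ 2 + u₄ ^ 2 + u₅ ^ 2 + u₆ ^ 2) - (v₁ ^ 2 + v₂ ^ 2 + v₃ ^ 2 + v₄ ^ 2)) ^ 2) := by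
  have hQ2 := Q2_nonneg_64_ample A₁ A₂ A₃ A₄ A₅ A₆ B₁ B₂ B₃ B₄ u₁ u₂ u₃ u₄ u₅ u₆ v₁ v₂ v₃ v₄ hA hC hP1 hP2
    m₁₁ m₂₁ m₃₁ m₄₁ m₅₁ m₆₁ m₁₂ m₂₂ m₃₂ m₄₂ m₅₂ m₆₂ m₁₃ m₂₃ m₃₃ m₄₃ m₅₃ m₆₃ m₁₄ m₂₄ m₃₄ m₄₄ m₅₄ m₆₄
  exact add_nonneg hQ2 (mul_nonneg hl hQ4)

end Summit.HodgeConjecture.HodgeConjecture.WeilClassTestFormatSixFourQ2
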